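import Mathlib
import HarnessLib
import Literature.AlgebraicGeometry.Resolution.QuasiExcellentSchemes
import Literature.AlgebraicGeometry.Resolution.CofinalityFromPrincipalization
import Literature.AlgebraicGeometry.Resolution.SigmaMaxEliminationInDim
import Literature.AlgebraicGeometry.Resolution.BirationalDimensionInequality
import Literature.AlgebraicGeometry.Morphisms.AffineSpaceCompactification
import Literature.AlgebraicGeometry.Motives.CyclesPushforwardFacts
import Summits.ResolutionOfSingularities.ResolutionOfSingularities.Theorems.HomologicalConductorNoZenoStageRational

/-!
# Crux `NoZeno` / `NoZenoR` (stmt-ResolutionOfSingularities-16483 / -19943), line `sandwich-cluster`,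
# stub `stub_skyPointLifts` (P1.3′) — scheme half, part 1: a resolution of `Spec R` THROUGH a given
# regular local ring of a birational affine model (modulo Cossart–Jannsen–Saito Thm 1.2)

Route `ResolutionOfSingularities/HomologicalConductor`.  OURS (cell res-hironaka, crux chain W4.4, seat
res-D-pv-038 acting as res-L0-w44-stub-6; CHAIN v6 row «stub-6», skeleton v15 registered stub
`stub_skyPointLifts`); nothing here is a statement of the manuscript under review (Hironaka 2017);
AI-written, weaker than expert review.

The registered stub `stub_skyPointLifts` asks for a lift `Spec S ⟶ X` of `Spec S → Spec T_m` through an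
ARBITRARY minimal resolution `π : X ⟶ Spec T_m` (`IsMinimalResolution` = universal property among
resolutions).  Such a lift exists as soon as SOME resolution `ρ : X″ ⟶ Spec T_m` passes through `S`
(`j : Spec S ⟶ X″` over `Spec T_m`): compose `j` with the factorisation `X″ ⟶ X`.  This file produces
`(X″, ρ, j)` for the local ring `S = B_𝔮` of a REGULAR point of a birational affine model `Spec B → Spec R`
of finite type (`R` an excellent Noetherian domain of dimension `≤ 2`), MODULO the named fact
`CossartJannsenSaito2020General` (Cossart–Jannsen–Saito 2020, Thm 1.2, in the form «the resolution is an
isomorphism over `Reg`»; the weak form `CossartJannsenSaito2020` = F-04 does not suffice, a resolution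
that blows up the regular point loses it):

* `isBirational_of_isOpenImmersion_comp` — birationality DESCENDS along a dense open immersion: if
  `j : Y ⟶ W` is an open immersion into an irreducible `W`, `q : W ⟶ Z` is separated and `j ≫ q` is
  birational, then `q` is birational (over the open where `j ≫ q` is an isomorphism the open immersion
  `j` is a closed immersion too — a section of a separated morphism — hence, `W` being irreducible, an
  isomorphism);
* **`exists_isResolution_through_of_cjsGeneral`** — the construction: compactify the affine model
  (tree `exists_compactification_of_isAffine`: an open immersion into a proper `R`-scheme, then the
  scheme-theoretic image, integral by `isIntegral_image_of_isIntegral`), check that the model `W` is a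
  reduced Noetherian excellent scheme of dimension `≤ 2` (excellence of finite-type schemes over the
  excellent `R`, `isExcellentRing_sections_of_locallyOfFiniteType`; dimension by
  `IsBirational.topologicalKrullDim_eq_of_isProper`), resolve it by `CossartJannsenSaito2020General`
  (an isomorphism over `U = Reg W`), observe that the point `w = j(𝔮)` is regular
  (`𝒪_{W,w} ≅ 𝒪_{Spec B,𝔮} ≅ B_𝔮 ≅ S`), so that `Spec S ⟶ W` factors through `U` (every point of
  `Spec S` generalises the closed point) and lifts along `(ρ ∣_ U)⁻¹`;
* `exists_lift_of_isMinimalResolution_of_through` — the one-line consequence for a minimal resolution.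

References: V. Cossart, U. Jannsen, S. Saito, LNM 2270 (2020), Thm 1.2 [`CossartJannsenSaito2020`];
The Stacks Project, Tags 01RN, 0F41, 01R8 [`StacksProject`]; B. Conrad, Deligne's notes on Nagata
compactifications (2007), Thm 4.1 [`Conrad2007`].
-/

noncomputable section

-- single-problem summit: the doubled namespace component `ResolutionOfSingularities` is forced
set_option linter.dupNamespace false

namespace Summit.ResolutionOfSingularities.ResolutionOfSingularities.Theorems.NoZeno.SandwichCluster

open CategoryTheory AlgebraicGeometry TopologicalSpace IsLocalRing
open Literature.AlgebraicGeometry.Resolution Literature.AlgebraicGeometry.Morphisms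

universe u

/-! ## Birationality descends along a dense open immersion -/

/-- **Birationality descends along an open immersion**: if `j : Y ⟶ W` is an open immersion with `Y`
non-empty and `W` irreducible, `q : W ⟶ Z` is separated and `j ≫ q` is birational, then `q` is
birational.  Over the dense open `U ⊆ Z` where `j ≫ q` is an isomorphism, the restriction of `j` is an
open immersion whose composite with the separated `q ∣_ U` is an isomorphism, hence a closed immersion
with clopen, non-empty, therefore (irreducibility) full image: an isomorphism; so `q ∣_ U` is one.
[cite: StacksProject, Tag 01RN] -/
theorem isBirational_of_isOpenImmersion_comp {Y W Z : Scheme.{u}} [IrreducibleSpace W] [Nonempty Y]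
    (j : Y ⟶ W) [IsOpenImmersion j] (q : W ⟶ Z) [IsSeparated q]
    (h : IsBirational (j ≫ q)) : IsBirational q := by
  obtain ⟨U, hU, hUpre, hiso⟩ := h
  haveI := hiso
  obtain ⟨y, hy⟩ := hUpre.nonempty
  have hy' : j y ∈ q ⁻¹ᵁ U := hy
  haveI : Nonempty (↑(q ⁻¹ᵁ U) : Scheme.{u}) := ⟨⟨j y, hy'⟩⟩
  haveI : IrreducibleSpace (↑(q ⁻¹ᵁ U) : Scheme.{u}) := (q ⁻¹ᵁ U).ι.isOpenEmbedding.irreducibleSpace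
  -- the restriction of `j` over `U`
  set a := j ∣_ q ⁻¹ᵁ U with ha
  set b := q ∣_ U with hb
  haveI hab : IsIso (a ≫ b) := by
    rw [ha, hb, ← morphismRestrict_comp]
    exact hiso
  haveI : IsOpenImmersion a := IsZariskiLocalAtTarget.restrict ‹IsOpenImmersion j› _
  haveI : IsSeparated b := IsZariskiLocalAtTarget.restrict ‹IsSeparated q› _
  haveI : IsClosedImmersion a := IsClosedImmersion.of_comp a b
  -- the image of `a` is clopen and non-empty in the irreducible `q ⁻¹ U`, hence everything
  have hopen : IsOpen (Set.range a) := a.isOpenEmbedding.isOpen_range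
  have hclosed : IsClosed (Set.range a) := a.isClosedEmbedding.isClosed_range
  have hne : (Set.range a).Nonempty := ⟨a ⟨y, hy⟩, ⟨y, hy⟩, rfl⟩
  have hdense : Dense (Set.range a) := hopen.dense hne
  have huniv : Set.range a = Set.univ := by
    rw [← hclosed.closure_eq]; exact hdense.closure_eq
  haveI : IsIso a := isIso_of_isOpenImmersion_of_opensRange_eq_top a (by
    ext1; rw [Scheme.Hom.coe_opensRange, huniv]; rfl)
  haveI : IsIso b := IsIso.of_isIso_comp_left a b
  refine ⟨U, hU, (q ⁻¹ᵁ U).2.dense ⟨j y, hy'⟩, ?_⟩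
  rw [← hb]; infer_instance

/-! ## A resolution through a regular point of a birational affine model -/

/-- **A resolution of `Spec R` passing through a given regular local ring of a birational affine model**
(modulo Cossart–Jannsen–Saito, Thm 1.2, iso-over-`Reg` form).  Let `R` be an excellent Noetherian domain
of Krull dimension `≤ 2`, `B ⊇ R` a finitely generated `R`-algebra and a domain with a common denominator
`r ≠ 0` (`rⁿ b ∈ R` for all `b`; so `Spec B → Spec R` is a birational affine model of finite type), `𝔮` a
prime of `B` whose local ring `S = B_𝔮` is REGULAR.  Then there is a resolution of singularities
`ρ : X″ ⟶ Spec R` (proper, birational, `X″` regular) and a morphism `j : Spec S ⟶ X″` over `Spec R`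
(`j ≫ ρ = Spec (R → S)`).  Construction: compactify `Spec B → Spec R` to an integral proper model `W`
(open immersion + scheme-theoretic image; birationality descends to `W`); `W` is Noetherian, excellent
(finite type over the excellent `R`) of dimension `dim R ≤ 2`; Cossart–Jannsen–Saito resolve `W` by
`ρ₀ : X″ ⟶ W`, an isomorphism over `U = Reg W`; the point `w = j(𝔮)` has `𝒪_{W,w} ≅ B_𝔮 = S` regular, so
`Spec S ⟶ W` lands in `U` (all its points generalise the closed point) and lifts along `(ρ₀ ∣_ U)⁻¹`.
[cite: CossartJannsenSaito2020, Thm. 1.2] [cite: StacksProject, Tag 0F41] -/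
theorem exists_isResolution_through_of_cjsGeneral (hCJS : CossartJannsenSaito2020General.{u})
    {R B S : Type u} [CommRing R] [IsNoetherianRing R] [IsDomain R]
    (hRexc : IsExcellentRing R) (hdimR : ringKrullDim R ≤ 2)
    [CommRing B] [IsDomain B] [Algebra R B] [Algebra.FiniteType R B]
    (hinj : Function.Injective (algebraMap R B)) (r : R) (hr : r ≠ 0)
    (hB : ∀ b : B, ∃ n : ℕ, ∃ a : R, algebraMap R B a = algebraMap R B r ^ n * b)
    (𝔮 : Ideal B) [𝔮.IsPrime] [CommRing S] [Algebra B S] [Algebra R S] [IsScalarTower R B S]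
    [IsLocalization.AtPrime S 𝔮] (hS : IsRegularLocalRing S) :
    ∃ (X : Scheme.{u}) (ρ : X ⟶ Spec (.of R)), IsResolution ρ ∧
      ∃ j : Spec (.of S) ⟶ X, j ≫ ρ = Spec.map (CommRingCat.ofHom (algebraMap R S)) := by
  haveI : IsDomain (CommRingCat.of B) := ‹IsDomain B›
  haveI : IsDomain (CommRingCat.of R) := ‹IsDomain R›
  haveI : IsNoetherianRing (CommRingCat.of R) := ‹IsNoetherianRing R›
  haveI : IsLocalRing S := IsLocalization.AtPrime.isLocalRing S 𝔮
  haveI := hS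
  -- the affine model `g : Spec B → Spec R`, birational of finite type
  let g : Spec (.of B) ⟶ Spec (.of R) := Spec.map (CommRingCat.ofHom (algebraMap R B))
  haveI : LocallyOfFiniteType g := by
    rw [HasRingHomProperty.Spec_iff (P := @LocallyOfFiniteType)]
    exact RingHom.finiteType_algebraMap.mpr ‹Algebra.FiniteType R B›
  have hbir : IsBirational g := isBirational_specMap_of_denominator hinj r hr hB
  -- compactify, then pass to the scheme-theoretic image
  obtain ⟨Xc, j₀, gc, hj₀, hgc, hfac⟩ := exists_compactification_of_isAffine g
  haveI := hj₀
  haveI := hgc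
  haveI : QuasiCompact (j₀ ≫ gc) := by rw [hfac]; infer_instance
  haveI : QuasiCompact j₀ := .of_comp j₀ gc
  let W : Scheme.{u} := j₀.image
  let j : Spec (.of B) ⟶ W := j₀.toImage
  let gW : W ⟶ Spec (.of R) := j₀.imageι ≫ gc
  have hjgW : j ≫ gW = g := by
    rw [Scheme.Hom.toImage_imageι_assoc, hfac]
  haveI : IsIntegral W := Literature.AlgebraicGeometry.Motives.isIntegral_image_of_isIntegral j₀
  haveI : IsProper gW := inferInstance
  -- `W → Spec R` is birational
  have hbirW : IsBirational gW :=
    isBirational_of_isOpenImmersion_comp j gW (hjgW ▸ hbir)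
  -- `W` is Noetherian, excellent, of dimension `≤ 2`
  haveI : IsLocallyNoetherian W := LocallyOfFiniteType.isLocallyNoetherian gW
  haveI : CompactSpace W := QuasiCompact.compactSpace_of_compactSpace gW
  haveI : IsNoetherian W := {}
  have hWexc : Scheme.IsExcellent W := fun V =>
    isExcellentRing_sections_of_locallyOfFiniteType gW
      (Scheme.isExcellent_Spec_of_isExcellentRing R hRexc) V
  have hdimW : topologicalKrullDim W ≤ 2 := by
    rw [hbirW.topologicalKrullDim_eq_of_isProper]
    exact (le_of_eq (PrimeSpectrum.topologicalKrullDim_eq_ringKrullDim (R := R))).trans hdimR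
  -- Cossart–Jannsen–Saito: a resolution of `W` which is an isomorphism over `Reg W`
  obtain ⟨X', ρ, hρ, U, hU, hUiso⟩ := hCJS W hWexc hdimW
  haveI := hρ.isProper
  haveI := hUiso
  -- the point `w = j(𝔮)` is regular: `𝒪_{W,w} ≅ 𝒪_{Spec B,𝔮} ≅ B_𝔮 ≅ S`
  let q : Spec (.of B) := ⟨𝔮, ‹𝔮.IsPrime›⟩
  have hq_reg : IsRegularLocalRing (Localization.AtPrime 𝔮) :=
    IsRegularLocalRing.of_ringEquiv
      (IsLocalization.algEquiv 𝔮.primeCompl S (Localization.AtPrime 𝔮)).toRingEquiv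
  haveI := hq_reg
  have hstalkB : IsRegularLocalRing ((Spec (.of B)).presheaf.stalk q) :=
    IsRegularLocalRing.of_ringEquiv (Spec.stalkIso (.of B) q).commRingCatIsoToRingEquiv.symm
  haveI := hstalkB
  have hwreg : IsRegularLocalRing (W.presheaf.stalk (j q)) :=
    IsRegularLocalRing.of_ringEquiv (asIso (j.stalkMap q)).commRingCatIsoToRingEquiv.symm
  have hwU : j q ∈ U := by
    have h1 : j q ∈ Scheme.regularLocus W := hwreg
    rwa [← hU] at h1
  -- `u : Spec S → Spec B → W` lands in `U`
  let φ : CommRingCat.of B ⟶ CommRingCat.of S := CommRingCat.ofHom (algebraMap B S)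
  let u : Spec (.of S) ⟶ W := Spec.map φ ≫ j
  have hφq : Spec.map φ (closedPoint S) = q := by
    apply PrimeSpectrum.ext
    rw [Spec.map_apply]
    change ((maximalIdeal S).under B) = 𝔮
    exact IsLocalization.AtPrime.under_maximalIdeal S 𝔮
  have huc : u (closedPoint S) = j q := by
    rw [Scheme.Hom.comp_apply, hφq]
  have hrange : Set.range u ⊆ Set.range U.ι := by
    rw [Scheme.Opens.range_ι]
    rintro _ ⟨x, rfl⟩
    have hx : x ⤳ closedPoint S := IsLocalRing.specializes_closedPoint x
    have hux : u x ⤳ u (closedPoint S) := hx.map u.continuous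
    exact hux.mem_open U.2 (huc ▸ hwU)
  let u' : Spec (.of S) ⟶ (U : Scheme.{u}) := IsOpenImmersion.lift U.ι u hrange
  have hu' : u' ≫ U.ι = u := IsOpenImmersion.lift_fac _ _ _
  -- lift along `(ρ ∣_ U)⁻¹`
  let jX : Spec (.of S) ⟶ X' := u' ≫ inv (ρ ∣_ U) ≫ (ρ ⁻¹ᵁ U).ι
  have hjX : jX ≫ ρ = u := by
    simp only [jX, Category.assoc]
    rw [← morphismRestrict_ι, IsIso.inv_hom_id_assoc, hu']
  refine ⟨X', ρ ≫ gW, ⟨inferInstance, hρ.isBirational.comp hbirW, hρ.isRegular⟩, jX, ?_⟩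
  rw [← Category.assoc, hjX]
  change (Spec.map φ ≫ j) ≫ gW = _
  rw [Category.assoc, hjgW]
  change Spec.map φ ≫ Spec.map (CommRingCat.ofHom (algebraMap R B)) = _
  rw [← Spec.map_comp, ← CommRingCat.ofHom_comp, ← IsScalarTower.algebraMap_eq R B S]

/-! ## The lift through a minimal resolution -/

/-- **Lifting through a minimal resolution.**  If `π : X ⟶ Spec R` is a minimal resolution (every
resolution factors through it) and some resolution `ρ : X″ ⟶ Spec R` receives a morphism `j : Y ⟶ X″`,
then `Y ⟶ X″ ⟶ X` lifts `j ≫ ρ` through `π`. [folklore] -/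
theorem exists_lift_of_isMinimalResolution_of_through {X X'' Y S : Scheme.{u}} {π : X ⟶ S}
    (hπ : IsMinimalResolution π) {ρ : X'' ⟶ S} (hρ : IsResolution ρ) (j : Y ⟶ X'') :
    ∃ l : Y ⟶ X, l ≫ π = j ≫ ρ := by
  obtain ⟨g, hg⟩ := hπ.exists_fac ρ hρ
  exact ⟨j ≫ g, by rw [Category.assoc, hg]⟩

end Summit.ResolutionOfSingularities.ResolutionOfSingularities.Theorems.NoZeno.SandwichCluster

end
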